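import Summits.AtomisticToContinuum.HydrodynamicLimit.Theorems.RelayRaceLocalityNearConstantShortTimeHLGronwallTools
import HarnessLib

/-!
# Crux `NearConstantShortTimeHL` (stmt-AtomisticToContinuum-12502), line `small-tilt-domination`:
# Fubini along the hard-sphere flow

Support file for the crux `…Theses.RelayRaceLocality.NearConstantShortTimeHL`, line `small-tilt-domination`
(lead c3, wave 3), registered stub **`integral_integral_flow_swap`**.

For a hard-sphere flow `Φ` on `𝕋³`, a finite law `P ≪ Liouville`, a jointly measurable real observable `Y (r, z)`
dominated along the flow on a time window, `|Y (r, Φ_r z)| ≤ g z` for `r ∈ [a, b]` and good `z` with `g ∈ L¹(P)`: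

* the time integral `z ↦ ∫_a^b Y (r, Φ_r z) dr` is `P`-integrable;
* every time slice `z ↦ Y (r, Φ_r z)`, `r ∈ [a, b]`, is `P`-integrable;
* the expectation `r ↦ E_P Y (r, Φ_r ·)` is interval integrable on `[a, b]`;
* `E_P ∫_a^b Y (r, Φ_r z) dr = ∫_a^b E_P Y (r, Φ_r ·) dr`.

The only point is joint measurability: the structure `HardSphereFlow` records the measurability of each `Φ_r`, and
`(r, z) ↦ Φ_r z` is jointly measurable on `ℝ × good` (`HardSphereFlow.measurable_piecewise_flow`, packaged here as
`xb_exists_measurable_flow`: a measurable `F : ℝ × Config → Config` agreeing with the flow on good points). Good points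
being `P`-almost all points (`P ≪ Liouville`), the integrand `(r, z) ↦ Y (r, F (r, z))` is integrable on
`(a, b] × Config` for `dr ⊗ P` (dominated by `g ∘ snd`), and Mathlib's Fubini theorem applies.

No definitions, no named facts. References: R. K. Alexander, PhD thesis (1975) Ch. 2 (measurability of the flow).
-/

noncomputable section

namespace Summit.AtomisticToContinuum.HydrodynamicLimit.Theorems.NearConstantShortTimeHL

open scoped BigOperators ENNReal
open MeasureTheory Set Filter
open Literature.MathematicalPhysics.KineticTheory Literature.Analysis.FluidPDE Literature.Analysis.FunctionSpaces

variable {ε : ℝ} {n : ℕ}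

/-- **A jointly measurable version of the hard-sphere flow on `𝕋³`**: there is a measurable map
`F : ℝ × Config → Config` with `F (r, z) = Φ_r z` for every time `r` and every GOOD `z` (namely
`good.piecewise Φ_r id`, `HardSphereFlow.measurable_piecewise_flow`). [cite: Alexander1975, Ch. 2] -/
theorem xb_exists_measurable_flow (Φ : HardSphereFlow (Torus.geometry (Fin 3)) ε n) :
    ∃ F : ℝ × Config n (Fin 3) T3 → Config n (Fin 3) T3, Measurable F ∧
      ∀ r : ℝ, ∀ z ∈ Φ.good, F (r, z) = Φ.flow r z := by
  classical
  exact ⟨fun p => Φ.good.piecewise (Φ.flow p.1) id p.2, measurable_piecewise_flow_torus Φ,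
    fun r _ hz => piecewise_flow_of_mem Φ r hz⟩

/-- **Domination on a product with a finite time factor.** For finite measures `μ` on `ℝ` and `P` on phase space, a
measurable `W : ℝ × Config → ℝ` with `‖W (r, z)‖ ≤ g z` for `μ ⊗ P`-a.e. `(r, z)` and `g ∈ L¹(P)` is integrable on the
product (domination by `g ∘ snd`, `Integrable.comp_snd`, `Integrable.mono'`). [folklore] -/
theorem xb_integrable_prod_of_dominated {P : Measure (Config n (Fin 3) T3)} [IsFiniteMeasure P]
    {μ : Measure ℝ} [IsFiniteMeasure μ] {W : ℝ × Config n (Fin 3) T3 → ℝ} (hW : Measurable W)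
    {g : Config n (Fin 3) T3 → ℝ} (hg : Integrable g P)
    (hdom : ∀ᵐ p ∂(μ.prod P), ‖W p‖ ≤ g p.2) : Integrable W (μ.prod P) :=
  (hg.comp_snd μ).mono' hW.aestronglyMeasurable hdom

/-- **Fubini along the hard-sphere flow** (registered stub of line `small-tilt-domination`). For a finite law
`P ≪ Liouville` on the `n`-particle phase space over `𝕋³`, a jointly measurable `Y (r, z)` with
`|Y (r, Φ_r z)| ≤ g z` for all `r ∈ [a, b]` and all good `z`, `g ∈ L¹(P)`: the time integral
`z ↦ ∫_a^b Y (r, Φ_r z) dr` is `P`-integrable, each slice `z ↦ Y (r, Φ_r z)` (`r ∈ [a, b]`) is `P`-integrable,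
`r ↦ E_P Y (r, Φ_r ·)` is interval integrable on `[a, b]`, and the two iterated integrals agree. Proof: replace the
flow by its jointly measurable version (`xb_exists_measurable_flow`), which changes nothing for good, i.e. `P`-almost
all, initial data; then Mathlib's Fubini–Tonelli (`integral_integral_swap`, `Integrable.integral_prod_left/right`)
on `(a, b] × Config` with the measure `dr ⊗ P`. [folklore] -/
theorem integral_integral_flow_swap : ∀ {ε : ℝ} {n : ℕ} (Φ : HardSphereFlow (Torus.geometry (Fin 3)) ε n) (P : Measure (Config n (Fin 3) T3)) [IsFiniteMeasure P], P ≪ liouville (Torus.geometry (Fin 3)) n ε → ∀ {Y : ℝ × Config n (Fin 3) T3 → ℝ}, Measurable Y → ∀ {a b : ℝ}, a ≤ b → ∀ {g : Config n (Fin 3) T3 → ℝ}, Integrable g P → (∀ r ∈ Set.Icc a b, ∀ z ∈ Φ.good, |Y (r, Φ.flow r z)| ≤ g z) → Integrable (fun z => ∫ r in a..b, Y (r, Φ.flow r z)) P ∧ (∀ r ∈ Set.Icc a b, Integrable (fun z => Y (r, Φ.flow r z)) P) ∧ IntervalIntegrable (fun r => ∫ z, Y (r, Φ.flow r z) ∂P)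 volume a b ∧ ∫ z, (∫ r in a..b, Y (r, Φ.flow r z)) ∂P = ∫ r in a..b, ∫ z, Y (r, Φ.flow r z) ∂P := by
  intro ε n Φ P _ hP Y hY a b hab g hg hdom
  obtain ⟨F, hFm, hF⟩ := xb_exists_measurable_flow Φ
  -- the jointly measurable integrand and its agreement with `Y (r, Φ_r z)` on good points
  have hWm : Measurable fun p : ℝ × Config n (Fin 3) T3 => Y (p.1, F p) :=
    hY.comp (measurable_fst.prodMk hFm)
  have hWY : ∀ r : ℝ, ∀ z ∈ Φ.good, Y ((r, z).1, F (r, z)) = Y (r, Φ.flow r z) := by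
    intro r z hz
    rw [hF r z hz]
  have hgood : ∀ᵐ z ∂P, z ∈ Φ.good := hP.ae_le Φ.ae_mem_good
  -- integrability on the product `(a, b] × Config`
  have hWint : Integrable (fun p : ℝ × Config n (Fin 3) T3 => Y (p.1, F p))
      ((volume.restrict (Ioc a b)).prod P) := by
    refine xb_integrable_prod_of_dominated hWm hg ?_
    have h1 : ∀ᵐ p ∂((volume.restrict (Ioc a b)).prod P), p.2 ∈ Φ.good :=
      (Measure.quasiMeasurePreserving_snd (μ := volume.restrict (Ioc a b)) (ν := P)).ae hgood
    have h2 : ∀ᵐ p ∂((volume.restrict (Ioc a b)).prod P), p.1 ∈ Ioc a b :=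
      (Measure.quasiMeasurePreserving_fst (μ := volume.restrict (Ioc a b)) (ν := P)).ae
        (ae_restrict_mem measurableSet_Ioc)
    filter_upwards [h1, h2] with p hp1 hp2
    obtain ⟨r, z⟩ := p
    rw [Real.norm_eq_abs, hWY r z hp1]
    exact hdom r (Ioc_subset_Icc_self hp2) z hp1
  -- the inner time integrals agree on good points, the outer expectations agree at every time
  have hinner : ∀ z ∈ Φ.good,
      (∫ r in a..b, Y (r, Φ.flow r z)) = ∫ r in Ioc a b, Y ((r, z).1, F (r, z)) := by
    intro z hz
    rw [intervalIntegral.integral_of_le hab]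
    exact integral_congr_ae (Eventually.of_forall fun r => (hWY r z hz).symm)
  have houter : ∀ r : ℝ, (∫ z, Y (r, Φ.flow r z) ∂P) = ∫ z, Y ((r, z).1, F (r, z)) ∂P := by
    intro r
    refine integral_congr_ae ?_
    filter_upwards [hgood] with z hz
    exact (hWY r z hz).symm
  refine ⟨?_, ?_, ?_, ?_⟩
  · -- integrability of the time integral
    refine (hWint.integral_prod_right).congr ?_
    filter_upwards [hgood] with z hz
    exact (hinner z hz).symm
  · -- integrability of every slice
    intro r hr
    have hm : Measurable fun z => Y (r, Φ.flow r z) :=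
      hY.comp (measurable_const.prodMk (Φ.measurable_flow r))
    refine hg.mono' hm.aestronglyMeasurable ?_
    filter_upwards [hgood] with z hz
    rw [Real.norm_eq_abs]
    exact hdom r hr z hz
  · -- interval integrability of the expectation
    rw [intervalIntegrable_iff_integrableOn_Ioc_of_le hab]
    exact (hWint.integral_prod_left).congr (Eventually.of_forall fun r => (houter r).symm)
  · -- the swap
    calc ∫ z, (∫ r in a..b, Y (r, Φ.flow r z)) ∂P
        = ∫ z, (∫ r in Ioc a b, Y ((r, z).1, F (r, z))) ∂P := by
          refine integral_congr_ae ?_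
          filter_upwards [hgood] with z hz
          exact hinner z hz
      _ = ∫ r in Ioc a b, ∫ z, Y ((r, z).1, F (r, z)) ∂P :=
          (integral_integral_swap (f := fun r z => Y ((r, z).1, F (r, z))) hWint).symm
      _ = ∫ r in a..b, ∫ z, Y (r, Φ.flow r z) ∂P := by
          rw [intervalIntegral.integral_of_le hab]
          exact integral_congr_ae (Eventually.of_forall fun r => (houter r).symm)

end Summit.AtomisticToContinuum.HydrodynamicLimit.Theorems.NearConstantShortTimeHL

end
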